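import Summits.QuantumFields.YangMills.Theorems.ConvexGribovBodyCovarianceBoundMomentReduction
import Summits.QuantumFields.YangMills.Theorems.ConvexGribovBodyCovarianceBoundMomentConverse
import HarnessLib

/-!
# `CovarianceBound`: the momentum split of its `𝔤`-half — an exact trichotomy of the crux
# (crux stmt-QuantumFields-8780, crux-strategist census, 2026-08-17)

Route `QuantumFields/YangMills/ConvexGribovBody`, crux
`Summit.QuantumFields.YangMills.Theses.ConvexGribovBody.CovarianceBound`.

The landed files `…MomentReduction` / `…MomentConverse` prove `CovarianceBound ↔ LieModeBound ∧ PerpModeBound`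
(`𝔤`- and `𝔤^⊥`-halves). This file cuts the `𝔤`-half once more, along MOMENTUM, into

* `LieModeBoundZero` — the `p = 0` piece: the zero mode `Σ_y P_𝔤 A_j(y)` of the minimal-Coulomb-gauge field
  (by Kirchhoff / transversality it is `L ×` the flux of the gauge-fixed field through any transverse plane; it is
  where the certified spread torons live, `Negative.ToronTight`, and where absolute minimality can be used
  quantitatively through twisted / winding competitors — the one corner of the crux with a variational handle);
* `LieModeBoundPos` — the `p ≠ 0` piece: all non-zero spatial momenta (the transverse gauge-fixed modes; first-order
  gauge variations are blind to them — this piece is the Gribov–Zwanziger infrared-finiteness statement proper),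

and proves the glue `lieModeBound_of_zero_pos`, the composition
`covarianceBound_of_zero_pos_perp : LieModeBoundZero → LieModeBoundPos → PerpModeBound → CovarianceBound`
and the exactness `covarianceBound_iff_zero_pos_perp`. Pure logic over the landed reductions (constants:
`β₀ = max`, `S₀ = max`, `D = D₁ + D₂`, then `15(D + D₃)` inside `covarianceBound_of_modeBounds`).

Purpose: it is the typed DECOMPOSITION candidate of `Cruxes/CovarianceBound/STRATEGY-CENSUS.md` (§Decomposition, D2)
— the glue a `route edit --split CovarianceBound --into LieModeBoundZero LieModeBoundPos PerpModeBound` would cite.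
The split is NOT filed by the strategist (the census explains why: `LieModeBoundPos` remains the whole open problem;
only `LieModeBoundZero` has a live lever, idea card `twist-stiffness-envelope`); the decision is the human's /
tenure planner's. Design as in `…MomentReduction`: the pieces are `def … : Prop` (route-posited statements, open),
the theorems are conditional and close nothing.
-/

set_option autoImplicit false

noncomputable section

namespace Summit.QuantumFields.YangMills.Cruxes.CovarianceBound.SupportWindow

open scoped BigOperators Classical MeasureTheory Matrix
open MeasureTheory Literature.MathematicalPhysics.QuantumFieldTheory

/-- **Zero-mode piece of `LieModeBound`** (route-posited, OPEN): for every compact simple `G` and faithful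
unitary `r` there is `β₀` such that for `β ≥ β₀` there are `D > 0` and `S₀` with, on every torus `(2S+1)⁴`,
`S ≥ S₀`, for every polarisation `j`: `∫ sup_{h ∈ argmin coul(U,·)} ‖P_𝔤 Ĉ_j(0; U, h)‖²_F dμ_β(U) ≤ D (2S+1)³`
— CLT-order fluctuations of the `𝔤`-zero-mode `Σ_y P_𝔤 A_j(y)` of the minimal-Coulomb-gauge field
(`Ĉ_j(0) = Σ_y A_j(y)`). Configuration-wise the integrand reaches `≍ L · L³` on the fundamental modular region
(spread torons, `Negative.ToronTight`); the bound is the MEASURE's statement that coherent flat directions are rare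
at `L ≫ ξ(β)`. -/
def LieModeBoundZero : Prop :=
  ∀ (G : Type) [Group G] [TopologicalSpace G] [IsTopologicalGroup G] [CompactSpace G]
    [MeasurableSpace G] [BorelSpace G], IsCompactSimpleLieGroup G → ∀ r : LatticeRep G,
    ∃ β₀ : ℝ, ∀ β : ℝ, β₀ ≤ β → ∃ D : ℝ, 0 < D ∧ ∃ S₀ : ℕ, ∀ S : ℕ, S₀ ≤ S →
      ∀ j : Fin 3, ∫ U, supLieCosSq r S 0 j U ∂(wilson4 r β S) ≤ D * (2 * S + 1 : ℝ) ^ 3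

/-- **Non-zero-momentum piece of `LieModeBound`** (route-posited, OPEN): the same bound for every spatial
momentum `p ≠ 0` — the transverse modes of the minimal-Coulomb-gauge field, perturbatively `≍ g² L` at the lowest
momentum; Gribov–Zwanziger infrared finiteness proper. No mechanism on the record reaches it (STRATEGY-CENSUS.md). -/
def LieModeBoundPos : Prop :=
  ∀ (G : Type) [Group G] [TopologicalSpace G] [IsTopologicalGroup G] [CompactSpace G]
    [MeasurableSpace G] [BorelSpace G], IsCompactSimpleLieGroup G → ∀ r : LatticeRep G,
    ∃ β₀ : ℝ, ∀ β : ℝ, β₀ ≤ β → ∃ D : ℝ, 0 < D ∧ ∃ S₀ : ℕ, ∀ S : ℕ, S₀ ≤ S →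
      ∀ (p : Fin 3 → ZMod (2 * S + 1)) (j : Fin 3), p ≠ 0 →
        ∫ U, supLieCosSq r S p j U ∂(wilson4 r β S) ≤ D * (2 * S + 1 : ℝ) ^ 3

/-- **Glue**: the two momentum pieces give `LieModeBound` (`β₀ = max β₁ β₂`, `S₀ = max S₁ S₂`, `D = D₁ + D₂`). -/
theorem lieModeBound_of_zero_pos : LieModeBoundZero → LieModeBoundPos → LieModeBound := by
  intro h0 h1 G _ _ _ _ _ _ hG r
  obtain ⟨β₁, hβ₁⟩ := h0 G hG r
  obtain ⟨β₂, hβ₂⟩ := h1 G hG r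
  refine ⟨max β₁ β₂, fun β hβ => ?_⟩
  obtain ⟨D₁, hD₁, S₁, hS₁⟩ := hβ₁ β (le_trans (le_max_left _ _) hβ)
  obtain ⟨D₂, hD₂, S₂, hS₂⟩ := hβ₂ β (le_trans (le_max_right _ _) hβ)
  refine ⟨D₁ + D₂, by positivity, max S₁ S₂, fun S hS p j => ?_⟩
  have hL : (0 : ℝ) ≤ (2 * S + 1 : ℝ) ^ 3 := by positivity
  by_cases hp : p = 0
  · subst hp
    calc ∫ U, supLieCosSq r S 0 j U ∂(wilson4 r β S) ≤ D₁ * (2 * S + 1 : ℝ) ^ 3 :=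
          hS₁ S (le_trans (le_max_left _ _) hS) j
      _ ≤ (D₁ + D₂) * (2 * S + 1 : ℝ) ^ 3 := mul_le_mul_of_nonneg_right (by linarith) hL
  · calc ∫ U, supLieCosSq r S p j U ∂(wilson4 r β S) ≤ D₂ * (2 * S + 1 : ℝ) ^ 3 :=
          hS₂ S (le_trans (le_max_right _ _) hS) p j hp
      _ ≤ (D₁ + D₂) * (2 * S + 1 : ℝ) ^ 3 := mul_le_mul_of_nonneg_right (by linarith) hL

/-- **Converse glue** (restriction): `LieModeBound` gives both momentum pieces. -/
theorem zero_pos_of_lieModeBound : LieModeBound → LieModeBoundZero ∧ LieModeBoundPos := by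
  intro h
  refine ⟨fun G _ _ _ _ _ _ hG r => ?_, fun G _ _ _ _ _ _ hG r => ?_⟩
  · obtain ⟨β₀, hβ₀⟩ := h G hG r
    refine ⟨β₀, fun β hβ => ?_⟩
    obtain ⟨D, hD, S₀, hS₀⟩ := hβ₀ β hβ
    exact ⟨D, hD, S₀, fun S hS j => hS₀ S hS 0 j⟩
  · obtain ⟨β₀, hβ₀⟩ := h G hG r
    refine ⟨β₀, fun β hβ => ?_⟩
    obtain ⟨D, hD, S₀, hS₀⟩ := hβ₀ β hβ
    exact ⟨D, hD, S₀, fun S hS p j _ => hS₀ S hS p j⟩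

/-- **`CovarianceBound` from three pieces**: zero mode (`𝔤`), non-zero modes (`𝔤`), `𝔤^⊥`-part — the glue
`Sub₁ → Sub₂ → Sub₃ → CovarianceBound` of the census's decomposition candidate D2. -/
theorem covarianceBound_of_zero_pos_perp :
    LieModeBoundZero → LieModeBoundPos → PerpModeBound →
      Summit.QuantumFields.YangMills.Theses.ConvexGribovBody.CovarianceBound :=
  fun h0 h1 h2 => covarianceBound_of_modeBounds (lieModeBound_of_zero_pos h0 h1) h2

/-- **Exactness of the trichotomy**: `CovarianceBound ↔ LieModeBoundZero ∧ LieModeBoundPos ∧ PerpModeBound`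
(via the landed converse `modeBounds_of_covarianceBound`). The three pieces are a SPLIT of the crux, not a
weakening; for `SU(2)`-type representations the third is void (`supPerpCosSq_fundamental_two_eq_zero`). -/
theorem covarianceBound_iff_zero_pos_perp :
    Summit.QuantumFields.YangMills.Theses.ConvexGribovBody.CovarianceBound ↔
      LieModeBoundZero ∧ LieModeBoundPos ∧ PerpModeBound := by
  constructor
  · intro h
    obtain ⟨hL, hP⟩ := modeBounds_of_covarianceBound h
    exact ⟨(zero_pos_of_lieModeBound hL).1, (zero_pos_of_lieModeBound hL).2, hP⟩
  · rintro ⟨h0, h1, h2⟩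
    exact covarianceBound_of_zero_pos_perp h0 h1 h2

end Summit.QuantumFields.YangMills.Cruxes.CovarianceBound.SupportWindow

end
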